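import Literature.MathematicalPhysics.QuantumLattice.TorusLimitPointGroupCovariance
import Literature.MathematicalPhysics.QuantumLattice.HubbardTTPrimeWindowCertificateAnchorTransport
import HarnessLib

/-!
# Single-anchor transport of a `D₄`-REDUCED `t–t'` window certificate to any point of the `(t', U)`
# half-plane: orbit-mean soundness at the target, priced and Lipschitz forms

Family `hubbard` (topic `MathematicalPhysics/QuantumLattice`); the point-group companion of
`HubbardTTPrimeWindowCertificateAnchorTransport` (translation-reduced certificates, `γₗ = 1`), written for
the material-oracle stage S2 (cell `pub/hubbard-downfold`, seat unc-1, named gap G1 of the `U`-direction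
transport table): the PRODUCTION window certificates of the tree identify a monomial with its images under
the lattice translations AND the point group `D₄` of `ℤ²` (Han's reduction; `hypotheses.reduce.point_group`
of the certificate bundles), and their conclusion in a torus-limit ground state `ω` is the ORBIT MEAN
`|S|⁻¹ Σ_{g∈S} Re (ω∘g)_{Λ'}(Xw)` over the label set `S ∋ 1`
(`IsTorusLimitOf.re_sum_expect_d4_ge_of_window_certificate_TT'_ineq`). Such a certificate issued at the
anchor `(t, t'_A, U_A)` is moved to any target `(t'_P, U_P)` exactly as in the translation-only case:

* the transport IDENTITY `windowCertificate_TT'_transport` is an operator identity and does not see the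
  point-group labels, so the anchor certificate IS a `D₄`-reduced certificate at the target with objective
  `Xw + (t'_A − t'_P)(κ ΓE_{Φ(0,1,0)} − W_{t'}) + (U_A − U_P)(κ ΓE_{Φ(0,0,1)} − W_U)` and constant
  `c + κ(u − u')` (`W_{t'} = Σₖ[H_{Λ'}(0,1,0), ΓBₖ]`, `W_U = Σₖ[H_{Λ'}(0,0,1), ΓBₖ]` the coupling charges of
  the eom rows);
* the `D₄`-reduced soundness theorem AT THE TARGET reads the transported objective in the rotated states
  `ω ∘ g`, `g ∈ S`; by `TorusLimitPointGroupCovariance` the class of torus-limit ground states is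
  `D₄`-stable and the two conjugate observables take the SAME value in every `ω ∘ g` as in `ω`
  (`IsTorusLimitOf.meanEnergy_hubbardTTPrime_d4Act`: `K₂(ω∘g) = K₂(ω)`, `D(ω∘g) = D(ω)`), so they leave the
  orbit mean.

§1 `IsTorusLimitOf.re_sum_expect_d4_ge_of_window_certificate_TT'_ineq_transport`: for every torus-limit
   ground state `ω` at the target (`U_P ≥ 0`, certified cap `e(t,t'_P,U_P,n) ≤ u'`),
   `c + κ(u − u') − Σₖ‖aₖ‖ + (Σ_σ μ_σ)(n/2 − ν) − (t'_A − t'_P) κ K₂(ω) − (U_A − U_P) κ D(ω)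
      + |S|⁻¹ Σ_{g∈S} [(t'_A − t'_P) Re (ω∘g)_{Λ'}(W_{t'}) + (U_A − U_P) Re (ω∘g)_{Λ'}(W_U)]
      ≤ |S|⁻¹ Σ_{g∈S} Re (ω∘g)_{Λ'}(Xw)`
   (`(ω∘g)_{Λ'}(X) = ω_{gΛ'}(Γ(d4Emb g 0 Λ') X)` definitionally, `InfVolFermionState.d4Act_expect`).
§2 `…_transport_priced`: certified brackets `K₂(ω) ∈ [τlo, τhi]`, `D(ω) ∈ [dlo, dhi]` OF `ω` and the
   operator norms of the two charges (`|Re (ω∘g)(W)| ≤ ‖W‖` for every `g`) give the same priced word as in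
   the translation-only case, now for the orbit mean.
§3 `…_transport_lipschitz`: the a-priori Lipschitz form with the kinematic ranges `D ∈ [0, (n/2)²]`,
   `|K₂| ≤ 16/π²` (`U_P > 0`): the anchor word degrades by
   `|t'_A − t'_P|·(16κ/π² + ‖W_{t'}‖) + |U_A − U_P|·(κ(n/2)² + ‖W_U‖)` plus the cap re-booking `κ(u − u')`.
§4 `…_transport_U_d4` : the `U`-ray specialisation (`t'_P = t'_A`), the `D₄` twin of
   `HubbardTTPrimeUBoxWords` §4.

HONEST SCOPE: transport lemmas only — no number, no new certificate, no claim on the Hubbard ground state;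
the charged-word caveat of the parent theorem is unchanged; a `D₄`-reduced certificate bounds the ORBIT
MEAN of the objective, not the objective in a non-symmetric torus limit (same caveat as the parent).
Everything is PROVED; no definition, no named fact, no numerical input.

## Mathlib / tree search

REUSED: `windowCertificate_TT'_transport` (the identity), `IsTorusLimitOf.re_sum_expect_d4_ge_of_window_certificate_TT'_ineq`
(soundness at the target), `IsTorusLimitOf.meanEnergy_hubbardTTPrime_d4Act`,
`IsTorusLimitOf.meanEnergy_onSite_d4Act_eq_re_expect_docc` (`TorusLimitPointGroupCovariance`),
`IsTorusLimitOf.abs_meanEnergy_diagHop_le`, `IsTorusLimitOf.re_expect_docc_le_sq_half_density_of_groundState`,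
`re_expect_docc_nonneg`, `abs_re_expect_le`. `lean search 'd4_ge_of_window_certificate.*transport'`: nothing.

## References

* J. Wang et al., PRX 14 (2024) 031006, §III (observable bounds under an energy constraint). [cite: WangEtAl2024, §III]
* X. Han, arXiv:2006.06002 (2020), §3 (translation and point-group reduction of the square-lattice
  bootstrap, `F[U⁻¹ O U] = F[O]`). [cite: Han2020Bootstrap, §3]
* T. Koma, H. Tasaki, J. Stat. Phys. 76 (1994) 745, §1 (conjugate observables of linear couplings).
  [cite: KomaTasaki1994, §1]
* O. Bratteli, D. W. Robinson, OAQSM 1, 2nd ed., §4.3.1 (`ω ↦ ω ∘ τ_g`), Prop. 2.3.11 (`|ω(A)| ≤ ‖A‖`).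
  [cite: BratteliRobinsonI1987, §4.3.1]
* E. H. Lieb, M. Loss, Duke Math. J. 71 (1993) 337, §8 Thm. 8.2 (bathtub: the kinematic hopping range).
  [cite: LiebLoss1993, §8, Theorem 8.2]
-/

noncomputable section

namespace Literature.MathematicalPhysics.QuantumLattice

open Matrix Finset HubbardWave0 Literature.Probability.LatticeModels ThermodynamicLimit
open Literature.MathematicalPhysics.QuantumManyBody.StateRelaxation
open _root_.Filter
open scoped _root_.Topology ComplexOrder BigOperators

namespace InfVolFermionState

/-! ### §1 Orbit-mean soundness at the target: explicit conjugate terms -/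

/-- **One `D₄`-reduced certificate at `(t'_A, U_A)` bounds the orbit mean of the objective in the
torus-limit ground states at any `(t'_P, U_P)`.** Data: the `D₄`-reduced window identity of
`IsTorusLimitOf.re_sum_expect_d4_ge_of_window_certificate_TT'_ineq` (point-group labels `γₗ ∈ S`, `S ∋ 1`
closed under multiplication) issued at the anchor `(t, t'_A, U_A)` with `κ ≥ 0`; a target `U_P ≥ 0`,
`0 ≤ n < 2`, a certified cap `e(t,t'_P,U_P,n) ≤ u'`; `ω` a torus limit of unit `(rectN n (Ls j), S^z = 0)`
sector ground states of `hubbardTorusTT' (Ls j) t t'_P U_P`, `Ls → ∞`. Then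
`c + κ(u − u') − Σₖ ‖aₖ‖ + (Σ_σ μ_σ)(n/2 − ν) − (t'_A − t'_P) κ K₂(ω) − (U_A − U_P) κ Re ω(n_{0↑}n_{0↓})
   + |S|⁻¹ Σ_{g∈S} [(t'_A − t'_P) Re (ω∘g)_{Λ'}(W_{t'}) + (U_A − U_P) Re (ω∘g)_{Λ'}(W_U)]
   ≤ |S|⁻¹ Σ_{g∈S} Re (ω∘g)_{Λ'}(Xw)`,
`K₂(ω) = ω.meanEnergy Φ(0,1,0) 1`, `W_{t'} = Σₖ (H_{Λ'}(0,1,0) ΓBₖ − ΓBₖ H_{Λ'}(0,1,0))`,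
`W_U = Σₖ (H_{Λ'}(0,0,1) ΓBₖ − ΓBₖ H_{Λ'}(0,0,1))`, `ω∘g = ω.d4Act g`. The conjugate observables leave the
orbit mean because `K₂(ω∘g) = K₂(ω)` and `D(ω∘g) = D(ω)` for torus limits
(`IsTorusLimitOf.meanEnergy_hubbardTTPrime_d4Act`). [cite: WangEtAl2024, §III] [cite: Han2020Bootstrap, §3] -/
theorem IsTorusLimitOf.re_sum_expect_d4_ge_of_window_certificate_TT'_ineq_transport
    (t t'A UA t'P : ℝ) {UP : ℝ} (hUP : 0 ≤ UP) {n : ℝ} (hn0 : 0 ≤ n) (hn2 : n < 2) {κ u u' : ℝ}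
    (hκ : 0 ≤ κ) (hu' : ThermodynamicLimit.energyDensityTT' t t'P UP n ≤ u')
    {Λ Λ' : Finset (Site 2)} (hΛ : Λ ⊆ Λ') (h8 : thicken Λ 1 ⊆ Λ')
    (h0 : thicken ({0} : Finset (Site 2)) 1 ⊆ Λ') (hz : (0 : Site 2) ∈ Λ')
    {S : Finset (DihedralGroup 4)} (h1 : (1 : DihedralGroup 4) ∈ S) (hmul : ∀ a ∈ S, ∀ b ∈ S, a * b ∈ S)
    (Xw : FermionOp Λ') (μ : Fin 2 → ℝ) (ν : ℝ)
    {m : Type*} [Fintype m] [DecidableEq m] {Λm : Matrix m m ℂ} (hΛm : Λm.PosSemidef)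
    (O : m → FermionOp Λ')
    {κ' : Type*} (s : Finset κ') (B : κ' → FermionOp Λ)
    {ι : Type*} (tt : Finset ι) (γ : ι → DihedralGroup 4) (hγS : ∀ l ∈ tt, γ l ∈ S) (wv : ι → Site 2)
    (hsh : ∀ l, d4ShiftSet (γ l) (wv l) Λ ⊆ Λ') (Y : ι → FermionOp Λ)
    {ρ : Type*} (uu : Finset ρ) (b : ρ → ℂ) (cw : ρ → List (Orb (PolySite Λ') × Bool))
    (hcw : ∀ j ∈ uu, ladderCharge (cw j) ≠ 0 ∨ ladderSpinCharge (cw j) ≠ 0)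
    {δ : Type*} (ah : Finset δ) (dc : δ → ℝ) (V : δ → FermionOp Λ')
    {κ'' : Type*} (w : Finset κ'') (a : κ'' → ℂ) (word : κ'' → List (Orb (PolySite Λ') × Bool)) {c : ℝ}
    (hcert : Xw - (c : ℂ) • (1 : FermionOp Λ') -
        ∑ σ : Fin 2, ((μ σ : ℝ) : ℂ) • (nAt 0 hz σ - ((ν : ℝ) : ℂ) • (1 : FermionOp Λ')) -
        ((κ : ℝ) : ℂ) • (((u : ℝ) : ℂ) • (1 : FermionOp Λ') -
          fermionEmbed (PolySite.incl h0) ((hubbardTTPrimeFermionInteraction t t'A UA).meanEnergyObs 1)) =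
      gramForm Λm O +
        (∑ k ∈ s, ((hubbardTTPrimeFermionInteraction t t'A UA).localHamiltonian Λ' * fermionEmbed (PolySite.incl hΛ) (B k) -
            fermionEmbed (PolySite.incl hΛ) (B k) * (hubbardTTPrimeFermionInteraction t t'A UA).localHamiltonian Λ') +
          ∑ l ∈ tt, (fermionEmbed (PolySite.incl (hsh l)) (fermionEmbed (PolySite.d4Emb (γ l) (wv l) Λ) (Y l)) -
            fermionEmbed (PolySite.incl hΛ) (Y l)) +
          ∑ j ∈ uu, b j • ladderWord (cw j)) +
        (∑ m' ∈ ah, ((dc m' : ℝ) : ℂ) • ((V m')ᴴ - V m') + ∑ k ∈ w, a k • ladderWord (word k)))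
    {Ls : ℕ → ℕ} (hLs : Tendsto Ls atTop atTop)
    {ψ : ∀ L, Fock (Orb (FermionTorus 2 L))}
    (hψ : ∀ j, IsGroundStateInSector (hubbardTorusTT' (Ls j) t t'P UP)
      (ThermodynamicLimit.rectN n (Ls j)) 0 (ψ (Ls j)))
    (hψ1 : ∀ j, star (ψ (Ls j)) ⬝ᵥ ψ (Ls j) = 1)
    {ω : InfVolFermionState 2} (hω : ω.IsTorusLimitOf ψ Ls) :
    c + κ * (u - u') - ∑ k ∈ w, ‖a k‖ + (∑ σ : Fin 2, μ σ) * (n / 2 - ν) -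
        (t'A - t'P) * κ * ω.meanEnergy (hubbardTTPrimeFermionInteraction 0 1 0) 1 -
        (UA - UP) * κ * (ω.expect ({0} : Finset (Site 2))
          (nAt 0 (Finset.mem_singleton_self 0) 0 * nAt 0 (Finset.mem_singleton_self 0) 1)).re +
        (S.card : ℝ)⁻¹ * ∑ g ∈ S,
          ((t'A - t'P) * ((ω.d4Act g).expect Λ' (∑ k ∈ s,
            ((hubbardTTPrimeFermionInteraction 0 1 0).localHamiltonian Λ' * fermionEmbed (PolySite.incl hΛ) (B k) -
              fermionEmbed (PolySite.incl hΛ) (B k) * (hubbardTTPrimeFermionInteraction 0 1 0).localHamiltonian Λ'))).re +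
          (UA - UP) * ((ω.d4Act g).expect Λ' (∑ k ∈ s,
            ((hubbardTTPrimeFermionInteraction 0 0 1).localHamiltonian Λ' * fermionEmbed (PolySite.incl hΛ) (B k) -
              fermionEmbed (PolySite.incl hΛ) (B k) * (hubbardTTPrimeFermionInteraction 0 0 1).localHamiltonian Λ'))).re) ≤
      (S.card : ℝ)⁻¹ * ∑ g ∈ S, ((ω.d4Act g).expect Λ' Xw).re := by
  -- abbreviations for the two charges and the two one-point mean-energy observables
  set WT : FermionOp Λ' := ∑ k ∈ s,
    ((hubbardTTPrimeFermionInteraction 0 1 0).localHamiltonian Λ' * fermionEmbed (PolySite.incl hΛ) (B k) -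
      fermionEmbed (PolySite.incl hΛ) (B k) * (hubbardTTPrimeFermionInteraction 0 1 0).localHamiltonian Λ') with hWT
  set WU : FermionOp Λ' := ∑ k ∈ s,
    ((hubbardTTPrimeFermionInteraction 0 0 1).localHamiltonian Λ' * fermionEmbed (PolySite.incl hΛ) (B k) -
      fermionEmbed (PolySite.incl hΛ) (B k) * (hubbardTTPrimeFermionInteraction 0 0 1).localHamiltonian Λ') with hWU
  set ET : FermionOp Λ' := fermionEmbed (PolySite.incl h0) ((hubbardTTPrimeFermionInteraction 0 1 0).meanEnergyObs 1)
    with hET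
  set EU : FermionOp Λ' := fermionEmbed (PolySite.incl h0) ((hubbardTTPrimeFermionInteraction 0 0 1).meanEnergyObs 1)
    with hEU
  -- the transported identity at `(t'_P, U_P)`
  have hcert' := windowCertificate_TT'_transport t t'A UA t'P UP hΛ h0 hz Xw κ u u' μ ν (gramForm Λm O)
    (∑ l ∈ tt, (fermionEmbed (PolySite.incl (hsh l)) (fermionEmbed (PolySite.d4Emb (γ l) (wv l) Λ) (Y l)) -
        fermionEmbed (PolySite.incl hΛ) (Y l)) +
      ∑ j ∈ uu, b j • ladderWord (cw j))
    (∑ m' ∈ ah, ((dc m' : ℝ) : ℂ) • ((V m')ᴴ - V m') + ∑ k ∈ w, a k • ladderWord (word k)) s B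
    (c := c) (by rw [hcert]; abel)
  -- the tree's `D₄`-reduced soundness theorem at the target, applied to the transported identity
  have hmain := hω.re_sum_expect_d4_ge_of_window_certificate_TT'_ineq t t'P hUP hn0 hn2 hκ hu' hΛ h8 h0 hz h1 hmul
    _ μ ν hΛm O s B tt γ hγS wv hsh Y uu b cw hcw ah dc V w a word (c := c + κ * (u - u'))
    (by rw [hcert']; abel) hLs hψ hψ1
  -- read the transported objective in each rotated state `ω ∘ g`
  have hK : ∀ g : DihedralGroup 4, ((ω.d4Act g).expect Λ' ET).re =
      ω.meanEnergy (hubbardTTPrimeFermionInteraction 0 1 0) 1 := by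
    intro g
    rw [hET, (ω.d4Act g).compatible h0]
    exact hω.meanEnergy_hubbardTTPrime_d4Act 0 1 0 hLs g
  have hD : ∀ g : DihedralGroup 4, ((ω.d4Act g).expect Λ' EU).re =
      (ω.expect ({0} : Finset (Site 2))
        (nAt 0 (Finset.mem_singleton_self 0) 0 * nAt 0 (Finset.mem_singleton_self 0) 1)).re := by
    intro g
    rw [hEU, (ω.d4Act g).compatible h0]
    exact hω.meanEnergy_onSite_d4Act_eq_re_expect_docc hLs g
  have hread : ∀ g : DihedralGroup 4,
      (ω.expect (d4ShiftSet g 0 Λ') (fermionEmbed (PolySite.d4Emb g 0 Λ')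
        (Xw + ((t'A - t'P : ℝ) : ℂ) • (((κ : ℝ) : ℂ) • ET - WT) + ((UA - UP : ℝ) : ℂ) • (((κ : ℝ) : ℂ) • EU - WU)))).re =
      ((ω.d4Act g).expect Λ' Xw).re +
        ((t'A - t'P) * κ * ω.meanEnergy (hubbardTTPrimeFermionInteraction 0 1 0) 1 +
          (UA - UP) * κ * (ω.expect ({0} : Finset (Site 2))
            (nAt 0 (Finset.mem_singleton_self 0) 0 * nAt 0 (Finset.mem_singleton_self 0) 1)).re) -
        ((t'A - t'P) * ((ω.d4Act g).expect Λ' WT).re + (UA - UP) * ((ω.d4Act g).expect Λ' WU).re) := by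
    intro g
    rw [← d4Act_expect, map_add, map_add, Complex.add_re, Complex.add_re, map_smul, smul_eq_mul,
      Complex.re_ofReal_mul, map_sub, Complex.sub_re, map_smul, smul_eq_mul, Complex.re_ofReal_mul, hK g, map_smul,
      smul_eq_mul, Complex.re_ofReal_mul, map_sub, Complex.sub_re, map_smul, smul_eq_mul, Complex.re_ofReal_mul, hD g]
    ring
  rw [Finset.sum_congr rfl fun g _ => hread g, Finset.sum_sub_distrib, Finset.sum_add_distrib, Finset.sum_const,
    nsmul_eq_mul] at hmain
  -- divide the orbit sum by `|S|`: the conjugate terms are constant on the orbit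
  set XS : ℝ := ∑ g ∈ S, ((ω.d4Act g).expect Λ' Xw).re with hXS
  set LS : ℝ := ∑ g ∈ S, ((t'A - t'P) * ((ω.d4Act g).expect Λ' WT).re + (UA - UP) * ((ω.d4Act g).expect Λ' WU).re)
    with hLS
  set AB : ℝ := (t'A - t'P) * κ * ω.meanEnergy (hubbardTTPrimeFermionInteraction 0 1 0) 1 +
      (UA - UP) * κ * (ω.expect ({0} : Finset (Site 2))
        (nAt 0 (Finset.mem_singleton_self 0) 0 * nAt 0 (Finset.mem_singleton_self 0) 1)).re with hAB
  have hcard : (0 : ℝ) < S.card := Nat.cast_pos.2 (Finset.card_pos.2 ⟨1, h1⟩)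
  have hexp : (S.card : ℝ)⁻¹ * (XS + (S.card : ℝ) * AB - LS) = (S.card : ℝ)⁻¹ * XS + AB - (S.card : ℝ)⁻¹ * LS := by
    calc (S.card : ℝ)⁻¹ * (XS + (S.card : ℝ) * AB - LS)
        = (S.card : ℝ)⁻¹ * XS + (S.card : ℝ)⁻¹ * (S.card : ℝ) * AB - (S.card : ℝ)⁻¹ * LS := by ring
      _ = (S.card : ℝ)⁻¹ * XS + AB - (S.card : ℝ)⁻¹ * LS := by rw [inv_mul_cancel₀ hcard.ne', one_mul]
  rw [hexp] at hmain
  linarith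

/-! ### §2 Priced form: certified brackets for the conjugate observables, norms for the charges -/

/-- Sign-split pricing of a slope term: `x κ τ ≤ max (x κ τlo) (x κ τhi)` for `κ ≥ 0`, `τ ∈ [τlo, τhi]`.
[folklore] [cite: KomaTasaki1994, §1] -/
private theorem mul_mul_le_max_of_mem_d4 {x κ τ τlo τhi : ℝ} (hκ : 0 ≤ κ) (hlo : τlo ≤ τ) (hhi : τ ≤ τhi) :
    x * κ * τ ≤ max (x * κ * τlo) (x * κ * τhi) := by
  rcases le_total 0 x with hp | hm
  · exact (mul_le_mul_of_nonneg_left hhi (mul_nonneg hp hκ)).trans (le_max_right _ _)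
  · exact (mul_le_mul_of_nonpos_left hlo (mul_nonpos_of_nonpos_of_nonneg hm hκ)).trans (le_max_left _ _)

open scoped Matrix.Norms.L2Operator in
/-- **Norm pricing of an orbit-mean charge term**: `−|x| ‖W‖ ≤ |S|⁻¹ Σ_{g∈S} x Re (ω∘g)(W)` for nonempty
`S` (each `|Re (ω∘g)(W)| ≤ ‖W‖`). [cite: BratteliRobinsonI1987, Prop. 2.3.11] -/
theorem neg_abs_mul_norm_le_inv_card_mul_sum_mul_re_d4Act_expect (ω : InfVolFermionState 2)
    {Λ' : Finset (Site 2)} (x : ℝ) (W : FermionOp Λ') {S : Finset (DihedralGroup 4)} (hS : S.Nonempty) :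
    -(|x| * ‖W‖) ≤ (S.card : ℝ)⁻¹ * ∑ g ∈ S, x * ((ω.d4Act g).expect Λ' W).re := by
  have hcard : (0 : ℝ) < S.card := Nat.cast_pos.2 (Finset.card_pos.2 hS)
  have hg : ∀ g ∈ S, -(|x| * ‖W‖) ≤ x * ((ω.d4Act g).expect Λ' W).re := by
    intro g _
    have h1 : |x * ((ω.d4Act g).expect Λ' W).re| ≤ |x| * ‖W‖ := by
      rw [abs_mul]
      exact mul_le_mul_of_nonneg_left ((ω.d4Act g).abs_re_expect_le Λ' W) (abs_nonneg _)
    exact (abs_le.1 h1).1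
  have hsum := Finset.card_nsmul_le_sum S _ _ hg
  rw [nsmul_eq_mul] at hsum
  have h := mul_le_mul_of_nonneg_left hsum (inv_nonneg.2 hcard.le)
  rwa [← mul_assoc, inv_mul_cancel₀ hcard.ne', one_mul] at h

open scoped Matrix.Norms.L2Operator in
/-- **Priced transport of a `D₄`-reduced certificate.** Under the hypotheses of `…_transport`, certified
brackets for the two conjugate observables OF `ω` — `K₂(ω) ∈ [τlo, τhi]`, `Re ω(n_{0↑}n_{0↓}) ∈ [dlo, dhi]`
(box brackets, chords, or kinematic ranges) — and the operator norms of the two charges give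
`c + κ(u − u') − Σₖ ‖aₖ‖ + (Σ_σ μ_σ)(n/2 − ν)
   − max((t'_A−t'_P)κ τlo, (t'_A−t'_P)κ τhi) − max((U_A−U_P)κ dlo, (U_A−U_P)κ dhi)
   − |t'_A − t'_P| ‖W_{t'}‖ − |U_A − U_P| ‖W_U‖ ≤ |S|⁻¹ Σ_{g∈S} Re (ω∘g)_{Λ'}(Xw)`.
[cite: WangEtAl2024, §III] [cite: KomaTasaki1994, §1] -/
theorem IsTorusLimitOf.re_sum_expect_d4_ge_of_window_certificate_TT'_ineq_transport_priced
    (t t'A UA t'P : ℝ) {UP : ℝ} (hUP : 0 ≤ UP) {n : ℝ} (hn0 : 0 ≤ n) (hn2 : n < 2) {κ u u' : ℝ}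
    (hκ : 0 ≤ κ) (hu' : ThermodynamicLimit.energyDensityTT' t t'P UP n ≤ u')
    {Λ Λ' : Finset (Site 2)} (hΛ : Λ ⊆ Λ') (h8 : thicken Λ 1 ⊆ Λ')
    (h0 : thicken ({0} : Finset (Site 2)) 1 ⊆ Λ') (hz : (0 : Site 2) ∈ Λ')
    {S : Finset (DihedralGroup 4)} (h1 : (1 : DihedralGroup 4) ∈ S) (hmul : ∀ a ∈ S, ∀ b ∈ S, a * b ∈ S)
    (Xw : FermionOp Λ') (μ : Fin 2 → ℝ) (ν : ℝ)
    {m : Type*} [Fintype m] [DecidableEq m] {Λm : Matrix m m ℂ} (hΛm : Λm.PosSemidef)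
    (O : m → FermionOp Λ')
    {κ' : Type*} (s : Finset κ') (B : κ' → FermionOp Λ)
    {ι : Type*} (tt : Finset ι) (γ : ι → DihedralGroup 4) (hγS : ∀ l ∈ tt, γ l ∈ S) (wv : ι → Site 2)
    (hsh : ∀ l, d4ShiftSet (γ l) (wv l) Λ ⊆ Λ') (Y : ι → FermionOp Λ)
    {ρ : Type*} (uu : Finset ρ) (b : ρ → ℂ) (cw : ρ → List (Orb (PolySite Λ') × Bool))
    (hcw : ∀ j ∈ uu, ladderCharge (cw j) ≠ 0 ∨ ladderSpinCharge (cw j) ≠ 0)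
    {δ : Type*} (ah : Finset δ) (dc : δ → ℝ) (V : δ → FermionOp Λ')
    {κ'' : Type*} (w : Finset κ'') (a : κ'' → ℂ) (word : κ'' → List (Orb (PolySite Λ') × Bool)) {c : ℝ}
    (hcert : Xw - (c : ℂ) • (1 : FermionOp Λ') -
        ∑ σ : Fin 2, ((μ σ : ℝ) : ℂ) • (nAt 0 hz σ - ((ν : ℝ) : ℂ) • (1 : FermionOp Λ')) -
        ((κ : ℝ) : ℂ) • (((u : ℝ) : ℂ) • (1 : FermionOp Λ') -
          fermionEmbed (PolySite.incl h0) ((hubbardTTPrimeFermionInteraction t t'A UA).meanEnergyObs 1)) =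
      gramForm Λm O +
        (∑ k ∈ s, ((hubbardTTPrimeFermionInteraction t t'A UA).localHamiltonian Λ' * fermionEmbed (PolySite.incl hΛ) (B k) -
            fermionEmbed (PolySite.incl hΛ) (B k) * (hubbardTTPrimeFermionInteraction t t'A UA).localHamiltonian Λ') +
          ∑ l ∈ tt, (fermionEmbed (PolySite.incl (hsh l)) (fermionEmbed (PolySite.d4Emb (γ l) (wv l) Λ) (Y l)) -
            fermionEmbed (PolySite.incl hΛ) (Y l)) +
          ∑ j ∈ uu, b j • ladderWord (cw j)) +
        (∑ m' ∈ ah, ((dc m' : ℝ) : ℂ) • ((V m')ᴴ - V m') + ∑ k ∈ w, a k • ladderWord (word k)))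
    {Ls : ℕ → ℕ} (hLs : Tendsto Ls atTop atTop)
    {ψ : ∀ L, Fock (Orb (FermionTorus 2 L))}
    (hψ : ∀ j, IsGroundStateInSector (hubbardTorusTT' (Ls j) t t'P UP)
      (ThermodynamicLimit.rectN n (Ls j)) 0 (ψ (Ls j)))
    (hψ1 : ∀ j, star (ψ (Ls j)) ⬝ᵥ ψ (Ls j) = 1)
    {ω : InfVolFermionState 2} (hω : ω.IsTorusLimitOf ψ Ls)
    {τlo τhi dlo dhi : ℝ}
    (hτ : τlo ≤ ω.meanEnergy (hubbardTTPrimeFermionInteraction 0 1 0) 1 ∧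
      ω.meanEnergy (hubbardTTPrimeFermionInteraction 0 1 0) 1 ≤ τhi)
    (hd : dlo ≤ (ω.expect ({0} : Finset (Site 2))
        (nAt 0 (Finset.mem_singleton_self 0) 0 * nAt 0 (Finset.mem_singleton_self 0) 1)).re ∧
      (ω.expect ({0} : Finset (Site 2))
        (nAt 0 (Finset.mem_singleton_self 0) 0 * nAt 0 (Finset.mem_singleton_self 0) 1)).re ≤ dhi) :
    c + κ * (u - u') - ∑ k ∈ w, ‖a k‖ + (∑ σ : Fin 2, μ σ) * (n / 2 - ν) -
        max ((t'A - t'P) * κ * τlo) ((t'A - t'P) * κ * τhi) -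
        max ((UA - UP) * κ * dlo) ((UA - UP) * κ * dhi) -
        |t'A - t'P| * ‖∑ k ∈ s,
          ((hubbardTTPrimeFermionInteraction 0 1 0).localHamiltonian Λ' * fermionEmbed (PolySite.incl hΛ) (B k) -
            fermionEmbed (PolySite.incl hΛ) (B k) * (hubbardTTPrimeFermionInteraction 0 1 0).localHamiltonian Λ')‖ -
        |UA - UP| * ‖∑ k ∈ s,
          ((hubbardTTPrimeFermionInteraction 0 0 1).localHamiltonian Λ' * fermionEmbed (PolySite.incl hΛ) (B k) -
            fermionEmbed (PolySite.incl hΛ) (B k) * (hubbardTTPrimeFermionInteraction 0 0 1).localHamiltonian Λ')‖ ≤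
      (S.card : ℝ)⁻¹ * ∑ g ∈ S, ((ω.d4Act g).expect Λ' Xw).re := by
  have h := hω.re_sum_expect_d4_ge_of_window_certificate_TT'_ineq_transport t t'A UA t'P hUP hn0 hn2 hκ hu' hΛ
    h8 h0 hz h1 hmul Xw μ ν hΛm O s B tt γ hγS wv hsh Y uu b cw hcw ah dc V w a word hcert hLs hψ hψ1
  have hS : S.Nonempty := ⟨1, h1⟩
  have hT := mul_mul_le_max_of_mem_d4 (x := t'A - t'P) hκ hτ.1 hτ.2
  have hD := mul_mul_le_max_of_mem_d4 (x := UA - UP) hκ hd.1 hd.2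
  have hWT := neg_abs_mul_norm_le_inv_card_mul_sum_mul_re_d4Act_expect ω (t'A - t'P) (∑ k ∈ s,
    ((hubbardTTPrimeFermionInteraction 0 1 0).localHamiltonian Λ' * fermionEmbed (PolySite.incl hΛ) (B k) -
      fermionEmbed (PolySite.incl hΛ) (B k) * (hubbardTTPrimeFermionInteraction 0 1 0).localHamiltonian Λ')) hS
  have hWD := neg_abs_mul_norm_le_inv_card_mul_sum_mul_re_d4Act_expect ω (UA - UP) (∑ k ∈ s,
    ((hubbardTTPrimeFermionInteraction 0 0 1).localHamiltonian Λ' * fermionEmbed (PolySite.incl hΛ) (B k) -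
      fermionEmbed (PolySite.incl hΛ) (B k) * (hubbardTTPrimeFermionInteraction 0 0 1).localHamiltonian Λ')) hS
  have hsplit : (S.card : ℝ)⁻¹ * ∑ g ∈ S,
      ((t'A - t'P) * ((ω.d4Act g).expect Λ' (∑ k ∈ s,
        ((hubbardTTPrimeFermionInteraction 0 1 0).localHamiltonian Λ' * fermionEmbed (PolySite.incl hΛ) (B k) -
          fermionEmbed (PolySite.incl hΛ) (B k) * (hubbardTTPrimeFermionInteraction 0 1 0).localHamiltonian Λ'))).re +
      (UA - UP) * ((ω.d4Act g).expect Λ' (∑ k ∈ s,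
        ((hubbardTTPrimeFermionInteraction 0 0 1).localHamiltonian Λ' * fermionEmbed (PolySite.incl hΛ) (B k) -
          fermionEmbed (PolySite.incl hΛ) (B k) * (hubbardTTPrimeFermionInteraction 0 0 1).localHamiltonian Λ'))).re) =
      (S.card : ℝ)⁻¹ * ∑ g ∈ S, (t'A - t'P) * ((ω.d4Act g).expect Λ' (∑ k ∈ s,
        ((hubbardTTPrimeFermionInteraction 0 1 0).localHamiltonian Λ' * fermionEmbed (PolySite.incl hΛ) (B k) -
          fermionEmbed (PolySite.incl hΛ) (B k) * (hubbardTTPrimeFermionInteraction 0 1 0).localHamiltonian Λ'))).re +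
      (S.card : ℝ)⁻¹ * ∑ g ∈ S, (UA - UP) * ((ω.d4Act g).expect Λ' (∑ k ∈ s,
        ((hubbardTTPrimeFermionInteraction 0 0 1).localHamiltonian Λ' * fermionEmbed (PolySite.incl hΛ) (B k) -
          fermionEmbed (PolySite.incl hΛ) (B k) * (hubbardTTPrimeFermionInteraction 0 0 1).localHamiltonian Λ'))).re := by
    rw [Finset.sum_add_distrib, mul_add]
  rw [hsplit] at h
  linarith

/-! ### §3 The a-priori Lipschitz form (kinematic ranges of the conjugate observables) -/

open scoped Matrix.Norms.L2Operator in
/-- **Lipschitz form in `(t', U)` for a `D₄`-reduced certificate.** Under the hypotheses of `…_transport`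
with `U_P > 0`, the kinematic ranges `0 ≤ Re ω(n_{0↑}n_{0↓}) ≤ (n/2)²` and `|K₂(ω)| ≤ 16/π²` give
`c + κ(u − u') − Σₖ ‖aₖ‖ + (Σ_σ μ_σ)(n/2 − ν) − |t'_A − t'_P|·(16κ/π² + ‖W_{t'}‖)
   − |U_A − U_P|·(κ(n/2)² + ‖W_U‖) ≤ |S|⁻¹ Σ_{g∈S} Re (ω∘g)_{Λ'}(Xw)`:
the certified orbit-mean word of the anchor is Lipschitz in the couplings with these explicit constants
(plus the cap re-booking `κ(u − u')`). [cite: WangEtAl2024, §III] [cite: LiebLoss1993, §8, Theorem 8.2] -/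
theorem IsTorusLimitOf.re_sum_expect_d4_ge_of_window_certificate_TT'_ineq_transport_lipschitz
    (t t'A UA t'P : ℝ) {UP : ℝ} (hUP : 0 < UP) {n : ℝ} (hn0 : 0 ≤ n) (hn2 : n < 2) {κ u u' : ℝ}
    (hκ : 0 ≤ κ) (hu' : ThermodynamicLimit.energyDensityTT' t t'P UP n ≤ u')
    {Λ Λ' : Finset (Site 2)} (hΛ : Λ ⊆ Λ') (h8 : thicken Λ 1 ⊆ Λ')
    (h0 : thicken ({0} : Finset (Site 2)) 1 ⊆ Λ') (hz : (0 : Site 2) ∈ Λ')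
    {S : Finset (DihedralGroup 4)} (h1 : (1 : DihedralGroup 4) ∈ S) (hmul : ∀ a ∈ S, ∀ b ∈ S, a * b ∈ S)
    (Xw : FermionOp Λ') (μ : Fin 2 → ℝ) (ν : ℝ)
    {m : Type*} [Fintype m] [DecidableEq m] {Λm : Matrix m m ℂ} (hΛm : Λm.PosSemidef)
    (O : m → FermionOp Λ')
    {κ' : Type*} (s : Finset κ') (B : κ' → FermionOp Λ)
    {ι : Type*} (tt : Finset ι) (γ : ι → DihedralGroup 4) (hγS : ∀ l ∈ tt, γ l ∈ S) (wv : ι → Site 2)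
    (hsh : ∀ l, d4ShiftSet (γ l) (wv l) Λ ⊆ Λ') (Y : ι → FermionOp Λ)
    {ρ : Type*} (uu : Finset ρ) (b : ρ → ℂ) (cw : ρ → List (Orb (PolySite Λ') × Bool))
    (hcw : ∀ j ∈ uu, ladderCharge (cw j) ≠ 0 ∨ ladderSpinCharge (cw j) ≠ 0)
    {δ : Type*} (ah : Finset δ) (dc : δ → ℝ) (V : δ → FermionOp Λ')
    {κ'' : Type*} (w : Finset κ'') (a : κ'' → ℂ) (word : κ'' → List (Orb (PolySite Λ') × Bool)) {c : ℝ}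
    (hcert : Xw - (c : ℂ) • (1 : FermionOp Λ') -
        ∑ σ : Fin 2, ((μ σ : ℝ) : ℂ) • (nAt 0 hz σ - ((ν : ℝ) : ℂ) • (1 : FermionOp Λ')) -
        ((κ : ℝ) : ℂ) • (((u : ℝ) : ℂ) • (1 : FermionOp Λ') -
          fermionEmbed (PolySite.incl h0) ((hubbardTTPrimeFermionInteraction t t'A UA).meanEnergyObs 1)) =
      gramForm Λm O +
        (∑ k ∈ s, ((hubbardTTPrimeFermionInteraction t t'A UA).localHamiltonian Λ' * fermionEmbed (PolySite.incl hΛ) (B k) -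
            fermionEmbed (PolySite.incl hΛ) (B k) * (hubbardTTPrimeFermionInteraction t t'A UA).localHamiltonian Λ') +
          ∑ l ∈ tt, (fermionEmbed (PolySite.incl (hsh l)) (fermionEmbed (PolySite.d4Emb (γ l) (wv l) Λ) (Y l)) -
            fermionEmbed (PolySite.incl hΛ) (Y l)) +
          ∑ j ∈ uu, b j • ladderWord (cw j)) +
        (∑ m' ∈ ah, ((dc m' : ℝ) : ℂ) • ((V m')ᴴ - V m') + ∑ k ∈ w, a k • ladderWord (word k)))
    {Ls : ℕ → ℕ} (hLs : Tendsto Ls atTop atTop)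
    {ψ : ∀ L, Fock (Orb (FermionTorus 2 L))}
    (hψ : ∀ j, IsGroundStateInSector (hubbardTorusTT' (Ls j) t t'P UP)
      (ThermodynamicLimit.rectN n (Ls j)) 0 (ψ (Ls j)))
    (hψ1 : ∀ j, star (ψ (Ls j)) ⬝ᵥ ψ (Ls j) = 1)
    {ω : InfVolFermionState 2} (hω : ω.IsTorusLimitOf ψ Ls) :
    c + κ * (u - u') - ∑ k ∈ w, ‖a k‖ + (∑ σ : Fin 2, μ σ) * (n / 2 - ν) -
        |t'A - t'P| * (κ * (16 / Real.pi ^ 2) + ‖∑ k ∈ s,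
          ((hubbardTTPrimeFermionInteraction 0 1 0).localHamiltonian Λ' * fermionEmbed (PolySite.incl hΛ) (B k) -
            fermionEmbed (PolySite.incl hΛ) (B k) * (hubbardTTPrimeFermionInteraction 0 1 0).localHamiltonian Λ')‖) -
        |UA - UP| * (κ * (n / 2) ^ 2 + ‖∑ k ∈ s,
          ((hubbardTTPrimeFermionInteraction 0 0 1).localHamiltonian Λ' * fermionEmbed (PolySite.incl hΛ) (B k) -
            fermionEmbed (PolySite.incl hΛ) (B k) * (hubbardTTPrimeFermionInteraction 0 0 1).localHamiltonian Λ')‖) ≤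
      (S.card : ℝ)⁻¹ * ∑ g ∈ S, ((ω.d4Act g).expect Λ' Xw).re := by
  have hN : ∀ j, IsNParticle (rectN n (Ls j)) (ψ (Ls j)) := fun j => ((mem_szSector_iff _ _ _).1 (hψ j).1).1
  have hK := abs_le.1 (hω.abs_meanEnergy_diagHop_le hn0 hn2 hLs hN hψ1)
  have hd0 : 0 ≤ (ω.expect ({0} : Finset (Site 2))
      (nAt 0 (Finset.mem_singleton_self 0) 0 * nAt 0 (Finset.mem_singleton_self 0) 1)).re :=
    ω.re_expect_docc_nonneg
  have hd1 := hω.re_expect_docc_le_sq_half_density_of_groundState t t'P hUP hn0 hn2 hLs hψ hψ1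
  have h := hω.re_sum_expect_d4_ge_of_window_certificate_TT'_ineq_transport_priced t t'A UA t'P hUP.le hn0 hn2
    hκ hu' hΛ h8 h0 hz h1 hmul Xw μ ν hΛm O s B tt γ hγS wv hsh Y uu b cw hcw ah dc V w a word hcert hLs hψ hψ1
    ⟨hK.1, hK.2⟩ ⟨hd0, hd1⟩
  -- the two `max` terms are bounded by the symmetric Lipschitz constants
  have hT : max ((t'A - t'P) * κ * (-(16 / Real.pi ^ 2))) ((t'A - t'P) * κ * (16 / Real.pi ^ 2)) ≤
      |t'A - t'P| * (κ * (16 / Real.pi ^ 2)) := by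
    have hc : 0 ≤ κ * (16 / Real.pi ^ 2) := mul_nonneg hκ (by positivity)
    refine max_le ?_ ?_
    · have : (t'A - t'P) * κ * (-(16 / Real.pi ^ 2)) = (-(t'A - t'P)) * (κ * (16 / Real.pi ^ 2)) := by ring
      rw [this]
      exact mul_le_mul_of_nonneg_right (neg_le_abs _) hc
    · rw [mul_assoc]
      exact mul_le_mul_of_nonneg_right (le_abs_self _) hc
  have hD : max ((UA - UP) * κ * 0) ((UA - UP) * κ * (n / 2) ^ 2) ≤ |UA - UP| * (κ * (n / 2) ^ 2) := by
    have hc : 0 ≤ κ * (n / 2) ^ 2 := mul_nonneg hκ (sq_nonneg _)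
    refine max_le ?_ ?_
    · rw [mul_zero]
      exact mul_nonneg (abs_nonneg _) hc
    · rw [mul_assoc]
      exact mul_le_mul_of_nonneg_right (le_abs_self _) hc
  nlinarith [hT, hD, h, norm_nonneg (∑ k ∈ s,
      ((hubbardTTPrimeFermionInteraction 0 1 0).localHamiltonian Λ' * fermionEmbed (PolySite.incl hΛ) (B k) -
        fermionEmbed (PolySite.incl hΛ) (B k) * (hubbardTTPrimeFermionInteraction 0 1 0).localHamiltonian Λ')),
    norm_nonneg (∑ k ∈ s,
      ((hubbardTTPrimeFermionInteraction 0 0 1).localHamiltonian Λ' * fermionEmbed (PolySite.incl hΛ) (B k) -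
        fermionEmbed (PolySite.incl hΛ) (B k) * (hubbardTTPrimeFermionInteraction 0 0 1).localHamiltonian Λ'))]

/-! ### §4 The `U`-ray specialisation: `D₄` twin of `HubbardTTPrimeUBoxWords` §4 -/

open scoped Matrix.Norms.L2Operator in
/-- **`D₄`-reduced certificate moved along the `U`-ray (`t'` fixed), Lipschitz form.** With `t'_P = t'_A`
the `t'`-terms vanish: for every torus-limit ground state `ω` at `(t, t'_A, U_P)`, `U_P > 0`,
`c + κ(u − u') − Σₖ ‖aₖ‖ + (Σ_σ μ_σ)(n/2 − ν) − |U_A − U_P|·(κ(n/2)² + ‖W_U‖) ≤ |S|⁻¹ Σ_{g∈S} Re (ω∘g)_{Λ'}(Xw)`.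
[cite: WangEtAl2024, §III] [cite: KomaTasaki1994, §1] -/
theorem IsTorusLimitOf.re_sum_expect_d4_ge_of_window_certificate_TT'_ineq_transport_U_lipschitz
    (t t' UA : ℝ) {UP : ℝ} (hUP : 0 < UP) {n : ℝ} (hn0 : 0 ≤ n) (hn2 : n < 2) {κ u u' : ℝ}
    (hκ : 0 ≤ κ) (hu' : ThermodynamicLimit.energyDensityTT' t t' UP n ≤ u')
    {Λ Λ' : Finset (Site 2)} (hΛ : Λ ⊆ Λ') (h8 : thicken Λ 1 ⊆ Λ')
    (h0 : thicken ({0} : Finset (Site 2)) 1 ⊆ Λ') (hz : (0 : Site 2) ∈ Λ')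
    {S : Finset (DihedralGroup 4)} (h1 : (1 : DihedralGroup 4) ∈ S) (hmul : ∀ a ∈ S, ∀ b ∈ S, a * b ∈ S)
    (Xw : FermionOp Λ') (μ : Fin 2 → ℝ) (ν : ℝ)
    {m : Type*} [Fintype m] [DecidableEq m] {Λm : Matrix m m ℂ} (hΛm : Λm.PosSemidef)
    (O : m → FermionOp Λ')
    {κ' : Type*} (s : Finset κ') (B : κ' → FermionOp Λ)
    {ι : Type*} (tt : Finset ι) (γ : ι → DihedralGroup 4) (hγS : ∀ l ∈ tt, γ l ∈ S) (wv : ι → Site 2)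
    (hsh : ∀ l, d4ShiftSet (γ l) (wv l) Λ ⊆ Λ') (Y : ι → FermionOp Λ)
    {ρ : Type*} (uu : Finset ρ) (b : ρ → ℂ) (cw : ρ → List (Orb (PolySite Λ') × Bool))
    (hcw : ∀ j ∈ uu, ladderCharge (cw j) ≠ 0 ∨ ladderSpinCharge (cw j) ≠ 0)
    {δ : Type*} (ah : Finset δ) (dc : δ → ℝ) (V : δ → FermionOp Λ')
    {κ'' : Type*} (w : Finset κ'') (a : κ'' → ℂ) (word : κ'' → List (Orb (PolySite Λ') × Bool)) {c : ℝ}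
    (hcert : Xw - (c : ℂ) • (1 : FermionOp Λ') -
        ∑ σ : Fin 2, ((μ σ : ℝ) : ℂ) • (nAt 0 hz σ - ((ν : ℝ) : ℂ) • (1 : FermionOp Λ')) -
        ((κ : ℝ) : ℂ) • (((u : ℝ) : ℂ) • (1 : FermionOp Λ') -
          fermionEmbed (PolySite.incl h0) ((hubbardTTPrimeFermionInteraction t t' UA).meanEnergyObs 1)) =
      gramForm Λm O +
        (∑ k ∈ s, ((hubbardTTPrimeFermionInteraction t t' UA).localHamiltonian Λ' * fermionEmbed (PolySite.incl hΛ) (B k) -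
            fermionEmbed (PolySite.incl hΛ) (B k) * (hubbardTTPrimeFermionInteraction t t' UA).localHamiltonian Λ') +
          ∑ l ∈ tt, (fermionEmbed (PolySite.incl (hsh l)) (fermionEmbed (PolySite.d4Emb (γ l) (wv l) Λ) (Y l)) -
            fermionEmbed (PolySite.incl hΛ) (Y l)) +
          ∑ j ∈ uu, b j • ladderWord (cw j)) +
        (∑ m' ∈ ah, ((dc m' : ℝ) : ℂ) • ((V m')ᴴ - V m') + ∑ k ∈ w, a k • ladderWord (word k)))
    {Ls : ℕ → ℕ} (hLs : Tendsto Ls atTop atTop)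
    {ψ : ∀ L, Fock (Orb (FermionTorus 2 L))}
    (hψ : ∀ j, IsGroundStateInSector (hubbardTorusTT' (Ls j) t t' UP)
      (ThermodynamicLimit.rectN n (Ls j)) 0 (ψ (Ls j)))
    (hψ1 : ∀ j, star (ψ (Ls j)) ⬝ᵥ ψ (Ls j) = 1)
    {ω : InfVolFermionState 2} (hω : ω.IsTorusLimitOf ψ Ls) :
    c + κ * (u - u') - ∑ k ∈ w, ‖a k‖ + (∑ σ : Fin 2, μ σ) * (n / 2 - ν) -
        |UA - UP| * (κ * (n / 2) ^ 2 + ‖∑ k ∈ s,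
          ((hubbardTTPrimeFermionInteraction 0 0 1).localHamiltonian Λ' * fermionEmbed (PolySite.incl hΛ) (B k) -
            fermionEmbed (PolySite.incl hΛ) (B k) * (hubbardTTPrimeFermionInteraction 0 0 1).localHamiltonian Λ')‖) ≤
      (S.card : ℝ)⁻¹ * ∑ g ∈ S, ((ω.d4Act g).expect Λ' Xw).re := by
  have h := hω.re_sum_expect_d4_ge_of_window_certificate_TT'_ineq_transport_lipschitz t t' UA t' hUP hn0 hn2 hκ
    hu' hΛ h8 h0 hz h1 hmul Xw μ ν hΛm O s B tt γ hγS wv hsh Y uu b cw hcw ah dc V w a word hcert hLs hψ hψ1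
  simp only [sub_self, abs_zero, zero_mul, sub_zero] at h
  exact h

end InfVolFermionState

end Literature.MathematicalPhysics.QuantumLattice
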